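import Literature.Probability.RandomPlanarGeometry.SAWStaircaseWalks
import Literature.Probability.RandomPlanarGeometry.SAWEndpointPieceInsertionZd
import HarnessLib

/-!
# An explicit long self-avoiding walk `0 → x` in `ℤ^d` with an insertion site (staircase followed by a planar hook)

Topic `Literature/Probability/RandomPlanarGeometry` (continues `SAWStaircaseWalks.lean`: `Staircase.stairs`; `SAWEndpointPieceInsertionZd.lean`:
the core classes `PieceInsertionZd.Core`; general-`d` twin of the three-segment walk `EndpointEnvelope.lWalk` of
`SAWEndpointLowerEnvelope.lean`).

Source: N. Madras, G. Slade, *The Self-Avoiding Walk* (1993), proof of Corollary 3.2.6 (book p. 68): a fixed self-avoiding walk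
`φ : 0 → z` "whose lexicographically largest point, `p`, is neither `0` nor `z(N)`" serves as the carrier of the inserted polygons.
Here, for `x ∈ ℤ^d` with `x_k ≠ 0` and a second coordinate `k' ≠ k`: first the staircase to `z = x − x_k e_k − x_{k'} e_{k'}`, then,
in the plane `z + span(e_k, e_{k'})`, the hook `K` steps in direction `−e_{k'}`, `|x_k|` steps in direction `sign(x_k) e_k`,
`x_{k'} + K` steps in direction `+e_{k'}`.  The lowest segment is an insertion site: the walk is extremal in direction `−e_{k'}` at
its start and turns into `sign(x_k) e_k` there.

* `Hook.mk2`, `Hook.hook`, `hook_mem_sawFun` — the planar hook `0 → x_k e_k + x_{k'} e_{k'}`;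
* `Hook.longWalk`, `longWalk_mem_sawFun`, **`longWalk_core`** — the staircase followed by the hook is a self-avoiding walk `0 → x` of
  length `longLen`, lying in the core class `Core longLen k' (-1) (sign(x_k) e_k) (len z d + K)`.
-/

noncomputable section

open Finset Literature.Probability.LatticeModels SimpleGraph

namespace Literature.Probability.RandomPlanarGeometry.SAW.Zd

namespace Hook

variable {d : ℕ} {k k' : Fin d}

/-! ### Sites of the plane `span(e_k, e_{k'})` -/

/-- The site `b e_k + a e_{k'}`. [folklore] -/
def mk2 (k k' : Fin d) (b a : ℤ) : Site d := Pi.single k b + Pi.single k' a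

/-- (plumbing) [folklore] -/
@[simp] private theorem mk2_apply_fst (h : k' ≠ k) (b a : ℤ) : mk2 k k' b a k = b := by
  simp [mk2, Pi.single_eq_of_ne h.symm]

/-- (plumbing) [folklore] -/
@[simp] private theorem mk2_apply_snd (h : k' ≠ k) (b a : ℤ) : mk2 k k' b a k' = a := by
  simp [mk2, Pi.single_eq_of_ne h]

/-- (plumbing) [folklore] -/
private theorem mk2_apply_of_ne {l : Fin d} (hl : l ≠ k) (hl' : l ≠ k') (b a : ℤ) : mk2 k k' b a l = 0 := by
  simp [mk2, Pi.single_eq_of_ne hl, Pi.single_eq_of_ne hl']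

/-- Two sites of the plane agree iff their two coordinates agree. [folklore] -/
private theorem mk2_ext {b a b' a' : ℤ} (h1 : b = b') (h2 : a = a') : mk2 k k' b a = mk2 k k' b' a' := by
  rw [h1, h2]

/-- Adjacency in the plane: same `k`-coordinate, `k'`-coordinates differing by one. [folklore] -/
private theorem adj_mk2_succ (b a : ℤ) : (zdGraph d).Adj (mk2 k k' b a) (mk2 k k' b (a + 1)) := by
  rw [zdGraph_adj_iff]
  refine ⟨k', Or.inl ?_⟩
  simp only [mk2, add_assoc, ← Pi.single_add]

/-- Adjacency in the plane: same `k'`-coordinate, `k`-coordinates differing by one. [folklore] -/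
private theorem adj_mk2_self (b a : ℤ) : (zdGraph d).Adj (mk2 k k' b a) (mk2 k k' (b + 1) a) := by
  rw [zdGraph_adj_iff]
  refine ⟨k, Or.inl ?_⟩
  simp only [mk2]
  rw [add_right_comm, ← Pi.single_add]

/-! ### The planar hook -/

variable {x : Site d}

/-- The hook: `K` steps in direction `−e_{k'}`, then `|x_k|` steps in direction `sign(x_k) e_k`, then `x_{k'} + K` steps in direction
`+e_{k'}` (for `K > |x_{k'}|`). [cite: MadrasSlade1993, Corollary 3.2.6 (proof: the fixed walk φ)] -/
def hook (x : Site d) (k k' : Fin d) (K : ℕ) (i : ℕ) : Site d :=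
  if i ≤ K then mk2 k k' 0 (-(i : ℤ))
  else if i ≤ K + (x k).natAbs then mk2 k k' ((x k).sign * ((i : ℤ) - K)) (-(K : ℤ))
  else if i ≤ K + (x k).natAbs + (x k' + K).toNat then mk2 k k' (x k) (-(K : ℤ) + ((i : ℤ) - K - (x k).natAbs))
  else mk2 k k' (x k) (x k')

/-- The length of the hook. [folklore] -/
def hookLen (x : Site d) (k k' : Fin d) (K : ℕ) : ℕ := K + (x k).natAbs + (x k' + K).toNat

/-- The three segments of the hook. [folklore] -/
private theorem hook_cases (K : ℕ) {i : ℕ} (hi : i ≤ hookLen x k k' K) :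
    (i ≤ K ∧ hook x k k' K i = mk2 k k' 0 (-(i : ℤ))) ∨
    (K < i ∧ i ≤ K + (x k).natAbs ∧ hook x k k' K i = mk2 k k' ((x k).sign * ((i : ℤ) - K)) (-(K : ℤ))) ∨
    (K + (x k).natAbs < i ∧ hook x k k' K i = mk2 k k' (x k) (-(K : ℤ) + ((i : ℤ) - K - (x k).natAbs))) := by
  unfold hookLen at hi
  by_cases h1 : i ≤ K
  · exact Or.inl ⟨h1, by simp [hook, h1]⟩
  by_cases h2 : i ≤ K + (x k).natAbs
  · exact Or.inr (Or.inl ⟨by omega, h2, by simp [hook, h1, h2]⟩)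
  · exact Or.inr (Or.inr ⟨by omega, by simp [hook, h1, h2, hi]⟩)

/-- **The hook is a self-avoiding walk `0 → x_k e_k + x_{k'} e_{k'}` of length `hookLen`** (for `x_k ≠ 0`, `k' ≠ k`, `K > |x_{k'}|`).
[cite: MadrasSlade1993, Corollary 3.2.6 (proof)] -/
theorem hook_mem_sawFun (hkk : k' ≠ k) (hxk : x k ≠ 0) {K : ℕ} (hK : (x k').natAbs < K) :
    hook x k k' K ∈ sawFun d (hookLen x k k' K) (mk2 k k' (x k) (x k')) := by
  have hA1 : 1 ≤ (x k).natAbs := Int.natAbs_pos.2 hxk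
  have hσA : (x k).sign * ((x k).natAbs : ℤ) = x k := Int.sign_mul_natAbs (x k)
  have hσ1 : (x k).sign = 1 ∨ (x k).sign = -1 := by
    rcases lt_or_gt_of_ne hxk with h | h
    · exact Or.inr (Int.sign_eq_neg_one_of_neg h)
    · exact Or.inl (Int.sign_eq_one_of_pos h)
  have hT : (((x k' + K).toNat : ℕ) : ℤ) = x k' + K := Int.toNat_of_nonneg (by omega)
  have hT1 : 1 ≤ (x k' + K).toNat := by omega
  -- coordinates of the hook
  have hck : ∀ {i}, i ≤ hookLen x k k' K → hook x k k' K i k =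
      (if i ≤ K then 0 else if i ≤ K + (x k).natAbs then (x k).sign * ((i : ℤ) - K) else x k) := by
    intro i hi
    rcases hook_cases (x := x) K hi with ⟨a, e⟩ | ⟨a, a', e⟩ | ⟨a, e⟩
    · rw [e, mk2_apply_fst hkk, if_pos a]
    · rw [e, mk2_apply_fst hkk, if_neg (by omega), if_pos a']
    · rw [e, mk2_apply_fst hkk, if_neg (by omega), if_neg (by omega)]
  have hck' : ∀ {i}, i ≤ hookLen x k k' K → hook x k k' K i k' =
      (if i ≤ K then -(i : ℤ) else if i ≤ K + (x k).natAbs then -(K : ℤ) else -(K : ℤ) + ((i : ℤ) - K - (x k).natAbs)) := by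
    intro i hi
    rcases hook_cases (x := x) K hi with ⟨a, e⟩ | ⟨a, a', e⟩ | ⟨a, e⟩
    · rw [e, mk2_apply_snd hkk, if_pos a]
    · rw [e, mk2_apply_snd hkk, if_neg (by omega), if_pos a']
    · rw [e, mk2_apply_snd hkk, if_neg (by omega), if_neg (by omega)]
  refine mem_sawFun.2 ⟨?_, fun i hi => ?_, fun i hi => ?_, fun a ha b hb hab => ?_⟩
  · -- start
    simp only [hook, Nat.zero_le, if_true]
    simp [mk2]
  · -- frozen
    rcases hi.eq_or_lt with h | h
    · rw [← h]
      rcases hook_cases (x := x) K (i := hookLen x k k' K) le_rfl with ⟨a1, -⟩ | ⟨-, a1, -⟩ | ⟨-, e⟩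
      · exfalso; unfold hookLen at a1; omega
      · exfalso; unfold hookLen at a1; omega
      · rw [e]; refine mk2_ext rfl ?_
        unfold hookLen; simp only [Nat.cast_add, hT]; ring
    · unfold hookLen at h
      unfold hook
      rw [if_neg (by omega), if_neg (by omega), if_neg (by omega)]
  · -- adjacency
    unfold hookLen at hi
    have hc1 := hook_cases (x := x) (k := k) (k' := k') K (i := i) (by unfold hookLen; omega)
    have hc2 := hook_cases (x := x) (k := k) (k' := k') K (i := i + 1) (by unfold hookLen; omega)
    rcases hc1 with ⟨a1, e1⟩ | ⟨a1, a1', e1⟩ | ⟨a1, e1⟩ <;>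
      rcases hc2 with ⟨a2, e2⟩ | ⟨a2, a2', e2⟩ | ⟨a2, e2⟩ <;>
      rw [e1, e2]
    · convert (adj_mk2_succ (k := k) (k' := k') 0 (-(((i + 1 : ℕ) : ℤ)))).symm using 2; push_cast; ring
    · have hiK : i = K := by omega
      subst hiK
      rcases hσ1 with h | h <;> rw [h]
      · convert adj_mk2_self (k := k) (k' := k') 0 (-(i : ℤ)) using 2; push_cast; ring
      · convert (adj_mk2_self (k := k) (k' := k') (-1) (-(i : ℤ))).symm using 2
        all_goals norm_num
    · omega
    · omega
    · rcases hσ1 with h | h <;> rw [h]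
      · convert adj_mk2_self (k := k) (k' := k') ((i : ℤ) - K) (-(K : ℤ)) using 2 <;> push_cast <;> ring
      · convert (adj_mk2_self (k := k) (k' := k') (-(((i + 1 : ℕ) : ℤ) - K)) (-(K : ℤ))).symm using 2 <;> push_cast <;> ring
    · have hiK : i = K + (x k).natAbs := by omega
      have e : (x k).sign * ((i : ℤ) - K) = x k := by rw [hiK, Nat.cast_add, add_sub_cancel_left]; exact hσA
      rw [e]
      convert adj_mk2_succ (k := k) (k' := k') (x k) (-(K : ℤ)) using 2; rw [hiK]; push_cast; ring
    · omega
    · omega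
    · convert adj_mk2_succ (k := k) (k' := k') (x k) (-(K : ℤ) + ((i : ℤ) - K - (x k).natAbs)) using 2; push_cast; ring
  · -- injectivity
    simp only [Set.mem_setOf_eq] at ha hb
    have ek : hook x k k' K a k = hook x k k' K b k := by rw [hab]
    have ek' : hook x k k' K a k' = hook x k k' K b k' := by rw [hab]
    rw [hck ha, hck hb] at ek
    rw [hck' ha, hck' hb] at ek'
    split_ifs at ek ek' <;>
      first
        | omega
        | (rcases hσ1 with h | h <;> rw [h] at ek <;> omega)

/-- The hook stays above the level `−K` in the coordinate `k'`. [cite: MadrasSlade1993, Corollary 3.2.6 (proof: "φ is contained in the half-space")] -/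
theorem hook_min (hkk : k' ≠ k) (K : ℕ) {i : ℕ} (hi : i ≤ hookLen x k k' K) : -(K : ℤ) ≤ hook x k k' K i k' := by
  rcases hook_cases (x := x) K hi with ⟨a, e⟩ | ⟨a, a', e⟩ | ⟨a, e⟩ <;> rw [e, mk2_apply_snd hkk] <;> omega

/-- At time `K` the hook is at `−K e_{k'}` and turns into `sign(x_k) e_k`. [cite: MadrasSlade1993, Lemma 7.3.3 (proof: the turn at the extreme point)] -/
theorem hook_turn (hxk : x k ≠ 0) (K : ℕ) :
    hook x k k' K K = mk2 k k' 0 (-(K : ℤ)) ∧ hook x k k' K (K + 1) = mk2 k k' 0 (-(K : ℤ)) + Pi.single k (x k).sign := by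
  have hA1 : 1 ≤ (x k).natAbs := Int.natAbs_pos.2 hxk
  refine ⟨by simp [hook], ?_⟩
  have h1 : ¬ K + 1 ≤ K := by omega
  have h2 : K + 1 ≤ K + (x k).natAbs := by omega
  simp only [hook, h1, h2, if_false, if_true, mk2]
  push_cast
  rw [show (K : ℤ) + 1 - K = 1 by ring, mul_one, add_right_comm, Pi.single_zero, zero_add]

/-- After its first step the hook has left the line `{y_k = y_{k'} = 0}`. [cite: MadrasSlade1993, Corollary 3.2.6 (proof)] -/
theorem hook_off_axis (hkk : k' ≠ k) (hxk : x k ≠ 0) {K i : ℕ} (hK1 : 1 ≤ K) (hi1 : 1 ≤ i) (hi : i ≤ hookLen x k k' K) :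
    hook x k k' K i k ≠ 0 ∨ hook x k k' K i k' ≠ 0 := by
  rcases hook_cases (x := x) K hi with ⟨a, e⟩ | ⟨a, a', e⟩ | ⟨a, e⟩
  · right; rw [e, mk2_apply_snd hkk]; omega
  · right; rw [e, mk2_apply_snd hkk]; omega
  · left; rw [e, mk2_apply_fst hkk]; exact hxk

/-- All coordinates of the hook other than `k, k'` vanish. [cite: MadrasSlade1993, Corollary 3.2.6 (proof)] -/
theorem hook_apply_of_ne {l : Fin d} (hl : l ≠ k) (hl' : l ≠ k') (K i : ℕ) : hook x k k' K i l = 0 := by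
  unfold hook; split_ifs <;> exact mk2_apply_of_ne hl hl' _ _

/-! ### The long walk: staircase, then hook -/

/-- The part of `x` off the plane: `x` with its coordinates `k, k'` set to `0`. [folklore] -/
def offPlane (x : Site d) (k k' : Fin d) : Site d := x - mk2 k k' (x k) (x k')

/-- (plumbing) [folklore] -/
private theorem offPlane_apply_fst (hkk : k' ≠ k) : offPlane x k k' k = 0 := by
  simp [offPlane, mk2_apply_fst hkk]

/-- (plumbing) [folklore] -/
private theorem offPlane_apply_snd (hkk : k' ≠ k) : offPlane x k k' k' = 0 := by
  simp [offPlane, mk2_apply_snd hkk]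

/-- **The long walk**: the staircase to `offPlane x` followed by the hook in the plane through it.
[cite: MadrasSlade1993, Corollary 3.2.6 (proof: the fixed walk φ from the origin to z(N))] -/
def longWalk (x : Site d) (k k' : Fin d) (K : ℕ) : ℕ → Site d :=
  concatWalk (Staircase.len (offPlane x k k') d) (Staircase.stairs (offPlane x k k') d) (hook x k k' K)

/-- The length of the long walk. [folklore] -/
def longLen (x : Site d) (k k' : Fin d) (K : ℕ) : ℕ := Staircase.len (offPlane x k k') d + hookLen x k k' K

/-- **The long walk is a self-avoiding walk `0 → x` of length `longLen`** (for `x_k ≠ 0`, `k' ≠ k`, `K > |x_{k'}|`, `K ≥ 1`).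
[cite: MadrasSlade1993, Corollary 3.2.6 (proof)] -/
theorem longWalk_mem_sawFun (hkk : k' ≠ k) (hxk : x k ≠ 0) {K : ℕ} (hK : (x k').natAbs < K) :
    longWalk x k k' K ∈ sawFun d (longLen x k k' K) x := by
  have hst := Staircase.stairs_mem_sawFun (offPlane x k k') d
  rw [Staircase.partial_self] at hst
  have hhk := hook_mem_sawFun hkk hxk hK
  rw [mem_sawFun_iff_mem_saws] at hst hhk ⊢
  refine ⟨?_, ?_⟩
  · refine concatWalk_mem_saws hst.1 hhk.1 fun i hi j hj1 hj2 hne => ?_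
    have h0k : Staircase.stairs (offPlane x k k') d i k = 0 := Staircase.stairs_apply_eq_zero (offPlane x k k') d i k (Or.inr (offPlane_apply_fst hkk))
    have h0k' : Staircase.stairs (offPlane x k k') d i k' = 0 := Staircase.stairs_apply_eq_zero (offPlane x k k') d i k' (Or.inr (offPlane_apply_snd hkk))
    have h1k : Staircase.stairs (offPlane x k k') d (Staircase.len (offPlane x k k') d) k = 0 :=
      Staircase.stairs_apply_eq_zero (offPlane x k k') d _ k (Or.inr (offPlane_apply_fst hkk))
    have h1k' : Staircase.stairs (offPlane x k k') d (Staircase.len (offPlane x k k') d) k' = 0 :=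
      Staircase.stairs_apply_eq_zero (offPlane x k k') d _ k' (Or.inr (offPlane_apply_snd hkk))
    have ek := congrArg (fun y : Site d => y k) hne
    have ek' := congrArg (fun y : Site d => y k') hne
    simp only [Pi.add_apply, h0k, h1k, h0k', h1k', zero_add] at ek ek'
    rcases hook_off_axis hkk hxk (by omega) hj1 hj2 with h | h
    · exact h ek.symm
    · exact h ek'.symm
  · unfold longWalk longLen
    simp only [concatWalk]
    by_cases h0 : hookLen x k k' K = 0
    · exfalso; unfold hookLen at h0; have := Int.natAbs_pos.2 hxk; omega
    · rw [if_neg (by omega), Nat.add_sub_cancel_left, hst.2, hhk.2, offPlane, sub_add_cancel]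

/-- **The long walk lies in a core class**: at time `len + K` it is extremal in direction `−e_{k'}` and turns into `sign(x_k) e_k`.
[cite: MadrasSlade1993, Lemma 7.3.3 (proof: the insertion time j) and Corollary 3.2.6 (proof)] -/
theorem longWalk_core (hkk : k' ≠ k) (hxk : x k ≠ 0) (K : ℕ) :
    PieceInsertionZd.Core (longLen x k k' K) k' (-1) (Pi.single k (x k).sign)
      (Staircase.len (offPlane x k k') d + K) (longWalk x k k' K) := by
  have hA1 : 1 ≤ (x k).natAbs := Int.natAbs_pos.2 hxk
  have hh0 : hook x k k' K 0 = 0 := by simp [hook, mk2]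
  obtain ⟨hK0, hK1⟩ := hook_turn (k' := k') hxk K
  have hval : ∀ i, longWalk x k k' K (Staircase.len (offPlane x k k') d + i) = Staircase.stairs (offPlane x k k') d (Staircase.len (offPlane x k k') d) + hook x k k' K i := by
    intro i
    simp only [longWalk, concatWalk]
    rcases Nat.eq_zero_or_pos i with rfl | hi
    · simp [hh0]
    · rw [if_neg (by omega), Nat.add_sub_cancel_left]
  refine ⟨by unfold longLen hookLen; omega, fun i hi => ?_, ?_⟩
  · -- extremality in direction `−e_{k'}`
    rw [hval K, Pi.add_apply, hK0, mk2_apply_snd hkk]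
    have hTk' : Staircase.stairs (offPlane x k k') d (Staircase.len (offPlane x k k') d) k' = 0 := Staircase.stairs_apply_eq_zero (offPlane x k k') d _ k' (Or.inr (offPlane_apply_snd hkk))
    rw [hTk']
    rcases le_or_gt i (Staircase.len (offPlane x k k') d) with h | h
    · -- staircase part: coordinate `k'` vanishes
      have : longWalk x k k' K i = Staircase.stairs (offPlane x k k') d i := by simp [longWalk, concatWalk, h]
      rw [this, Staircase.stairs_apply_eq_zero (offPlane x k k') d i k' (Or.inr (offPlane_apply_snd hkk))]
      omega
    · obtain ⟨i', rfl⟩ : ∃ i', i = Staircase.len (offPlane x k k') d + i' := ⟨i - Staircase.len (offPlane x k k') d, by omega⟩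
      rw [hval i', Pi.add_apply, hTk']
      have := hook_min (x := x) hkk K (i := i') (by unfold longLen at hi; omega)
      omega
  · rw [show Staircase.len (offPlane x k k') d + K + 1 = Staircase.len (offPlane x k k') d + (K + 1) by ring, hval (K + 1), hval K, hK1, hK0, add_assoc]

end Hook

end Literature.Probability.RandomPlanarGeometry.SAW.Zd
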